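import Literature.NumberTheory.EllipticCurves.UnramifiedLayerRootsProofs
import Literature.NumberTheory.EllipticCurves.KernelReductionDivisibleProofs
import Literature.NumberTheory.EllipticCurves.FormalGroupChart
import Mathlib.Algebra.Polynomial.Degree.SmallDegree
import HarnessLib

/-!
# Hensel lifts with descent to the unramified layer, I: roots near an approximate root, and
# points of the kernel of reduction with prescribed parameter in `K_v(ζ)`

`Proofs` file (theorems only, no definitions, no named facts) in topic
`NumberTheory/EllipticCurves`; a bottom-up step of the discharge of the named fact
`Literature.NumberTheory.EllipticCurves.Milne2006_unramifiedClass_eq_zero` (`PeriodIndexSupport`;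
Milne, *Arithmetic Duality Theorems*, Prop. I.3.8, whose printed proof is "Lang's lemma + Hensel's
lemma").  The Hensel input of the discharge consists of root lifts in the valuation ring `𝒪_w` of
`L = K̄_v` (algebraically closed, hence henselian: the tree's `exists_root_val_sub_lt_one` of
`KernelReductionDivisibleProofs`) followed by **descent to the layer `K_v(ζ)`** by uniqueness of
the lifted root.  This file provides:

* §1 (any valued field `(L, w)`) the elementary uniqueness half of Hensel's lemma: integral
  polynomials are `1`-Lipschitz on the valuation ring (`val_eval_sub_eval_le`), and **two
  congruent integral roots `s ≡ s'` of an integral polynomial with `|P'(s)| = 1` coincide**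
  (`eq_of_eval_eq_zero_of_val_derivative_eval_eq_one`: `0 = P(s') - P(s) = (s' - s) D` with
  `D ≡ P'(s)` a unit); packaged with existence over an algebraically closed `L` as
  `exists_root_near_unique` (Neukirch, *ANT*, II (4.6); Serre, *Local Fields*, II §4);
* §2 for the curve: hypothesis `hlift` of the abstract successive approximation
  `FormalGroupChart.exists_map_sub_eq_of_sum_eq_zero` (`UnramifiedFormalGroupH1Proofs`) —
  **every `z ∈ K_v(ζ)` with `|z|_v < 1` is the parameter `z(P)` of a point `P` of the kernel of
  reduction `E₁` with coordinates in `K_v(ζ)`** (`exists_mem_kernel_mem_range_zCoord_eq`): the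
  monic cubic of `FormalGroupChart.approxRoot` has a root `v ≡ -u` in `𝒪_w`
  (`exists_root_val_sub_lt_one`), giving a point `(-z y, y)`, `y = v/z³`, of `E₁` with parameter
  `z` (Silverman, *AEC*, Prop. VII.2.2: `z` is onto `𝓜`); for `σ ∈ Γ_{K_v}` fixing `ζ` the
  conjugate `σ y` is a root of the same cubic of the same size, hence `σ y = y`
  (`FormalGroupChart.root_unique`), so `y ∈ K_v(ζ)` by Galois descent
  (`mem_adjoin_of_forall_smul_eq`, `UnramifiedLayerRootsProofs`).

## References

* [SilvermanAEC2009] J. H. Silverman, *The Arithmetic of Elliptic Curves*, 2nd ed. (2009), IV.1,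
  Prop. VII.2.2 (`E₁(K) ≅ Ê(𝓜)` via `z = -x/y`).
* [NeukirchANT1999] J. Neukirch, *Algebraic Number Theory* (1999), Ch. II (4.6) (Hensel's lemma),
  (6.2).
* [MilneADT2006] J. S. Milne, *Arithmetic Duality Theorems*, 2nd ed. (2006), Prop. I.3.8.

## Design

No definitions; `noncomputable section`; `open scoped Classical NNReal Pointwise`; one universe
`u`.  §2 is stated for a Weierstrass equation `X` over `K_v` which is elliptic and whose base
change to `K̄_v` is `w`-integral (the good model of the discharge), the layer being
`IntermediateField.adjoin (v.adicCompletion K) {ζ}` as in `UnramifiedLayerRootsProofs`.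
-/

noncomputable section

open scoped Classical NNReal Pointwise
open NumberField IsDedekindDomain Polynomial

universe u

/-! ## §1 Integral polynomials on the valuation ring: Lipschitz estimate and unique root lifting -/

namespace Literature.NumberTheory.EllipticCurves

section Roots

variable {L : Type u} [Field L] (w : Valuation L ℝ≥0)

/-- `|aⁱ - bⁱ| ≤ |a - b|` on the valuation ring. [folklore] -/
theorem val_pow_sub_pow_le {a b : L} (ha : w a ≤ 1) (hb : w b ≤ 1) (i : ℕ) :
    w (a ^ i - b ^ i) ≤ w (a - b) := by
  rw [← geom_sum₂_mul, map_mul]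
  have hs : w (∑ j ∈ Finset.range i, a ^ j * b ^ (i - 1 - j)) ≤ 1 := by
    refine Valuation.map_sum_le w fun j _ ↦ ?_
    rw [map_mul, map_pow, map_pow]
    exact mul_le_one' (pow_le_one₀ zero_le ha) (pow_le_one₀ zero_le hb)
  calc w (∑ j ∈ Finset.range i, a ^ j * b ^ (i - 1 - j)) * w (a - b) ≤ 1 * w (a - b) := by gcongr
    _ = w (a - b) := one_mul _

/-- **Integral polynomials are `1`-Lipschitz on the valuation ring**: `|P(a) - P(b)| ≤ |a - b|`.
[folklore] -/
theorem val_eval_sub_eval_le {P : L[X]} (hP : ∀ i, w (P.coeff i) ≤ 1) {a b : L} (ha : w a ≤ 1)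
    (hb : w b ≤ 1) : w (P.eval a - P.eval b) ≤ w (a - b) := by
  rw [eval_eq_sum_range a, eval_eq_sum_range b, ← Finset.sum_sub_distrib]
  refine Valuation.map_sum_le w fun i _ ↦ ?_
  rw [← mul_sub, map_mul]
  calc w (P.coeff i) * w (a ^ i - b ^ i) ≤ 1 * w (a - b) := by
        gcongr
        · exact hP i
        · exact val_pow_sub_pow_le w ha hb i
    _ = w (a - b) := one_mul _

/-- The derivative of an integral polynomial is integral. [folklore] -/
theorem val_coeff_derivative_le {P : L[X]} (hP : ∀ i, w (P.coeff i) ≤ 1) (i : ℕ) :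
    w (P.derivative.coeff i) ≤ 1 := by
  rw [coeff_derivative, map_mul]
  refine mul_le_one' (hP _) ?_
  have : ((i : L) + 1) = ((i + 1 : ℕ) : L) := by push_cast; ring
  rw [this]
  exact FormalGroupChart.val_natCast_le_one w _

/-- An integral polynomial takes integral values on the valuation ring. [folklore] -/
theorem val_eval_le_one {P : L[X]} (hP : ∀ i, w (P.coeff i) ≤ 1) {a : L} (ha : w a ≤ 1) :
    w (P.eval a) ≤ 1 := by
  rw [eval_eq_sum_range]
  refine Valuation.map_sum_le w fun i _ ↦ ?_
  rw [map_mul, map_pow]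
  exact mul_le_one' (hP i) (pow_le_one₀ zero_le ha)

/-- **Uniqueness in Hensel's lemma**: two integral roots `s ≡ s' (mod 𝔪)` of an integral
polynomial `P` with `|P'(s)| = 1` are equal.  Proof: `0 = P(s') - P(s) = (s' - s) · D` with
`D = Σᵢ cᵢ Σ_{j<i} s'ʲ s^{i-1-j} ≡ Σᵢ i cᵢ s^{i-1} = P'(s)` modulo `𝔪` (since `s' ≡ s`), so `D` is
a unit and `s' = s`.  Neukirch, *ANT*, Ch. II (4.6). [cite: NeukirchANT1999, Ch. II (4.6)] -/
theorem eq_of_eval_eq_zero_of_val_derivative_eval_eq_one {P : L[X]} (hP : ∀ i, w (P.coeff i) ≤ 1)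
    {s s' : L} (hs : w s ≤ 1) (hs' : w s' ≤ 1) (hss : w (s' - s) < 1)
    (hd : w (P.derivative.eval s) = 1) (h0 : P.eval s = 0) (h0' : P.eval s' = 0) : s' = s := by
  set n := P.natDegree + 1 with hn
  -- the difference quotient `D`
  set G : ℕ → L := fun i ↦ ∑ j ∈ Finset.range i, s' ^ j * s ^ (i - 1 - j) with hG
  have hGmul : ∀ i, G i * (s' - s) = s' ^ i - s ^ i := fun i ↦ geom_sum₂_mul s' s i
  set D := ∑ i ∈ Finset.range n, P.coeff i * G i with hD
  have hdiff : P.eval s' - P.eval s = (s' - s) * D := by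
    rw [eval_eq_sum_range s', eval_eq_sum_range s, ← Finset.sum_sub_distrib, hD, Finset.mul_sum]
    refine Finset.sum_congr rfl fun i _ ↦ ?_
    rw [← mul_sub, ← hGmul]; ring
  -- the derivative
  have hder : P.derivative.eval s = ∑ i ∈ Finset.range n, P.coeff i * i * s ^ (i - 1) := by
    rw [derivative_eval, Polynomial.sum_over_range]
    intro i; simp
  -- `D ≡ P'(s)`
  have hGi : ∀ i, w (G i - i * s ^ (i - 1)) ≤ w (s' - s) := by
    intro i
    have e : G i - i * s ^ (i - 1) = ∑ j ∈ Finset.range i, (s' ^ j * s ^ (i - 1 - j) - s ^ (i - 1)) := by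
      rw [Finset.sum_sub_distrib, Finset.sum_const, Finset.card_range, nsmul_eq_mul]
    rw [e]
    refine Valuation.map_sum_le w fun j hj ↦ ?_
    have hj' : j < i := Finset.mem_range.mp hj
    have e2 : s' ^ j * s ^ (i - 1 - j) - s ^ (i - 1) = s ^ (i - 1 - j) * (s' ^ j - s ^ j) := by
      have : s ^ (i - 1) = s ^ (i - 1 - j) * s ^ j := by rw [← pow_add]; congr 1; omega
      rw [this]; ring
    rw [e2, map_mul, map_pow]
    calc w s ^ (i - 1 - j) * w (s' ^ j - s ^ j) ≤ 1 * w (s' - s) := by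
          gcongr
          · exact pow_le_one₀ zero_le hs
          · exact val_pow_sub_pow_le w hs' hs j
      _ = w (s' - s) := one_mul _
  have hDd : w (D - P.derivative.eval s) < 1 := by
    rw [hder, hD, ← Finset.sum_sub_distrib]
    refine lt_of_le_of_lt (Valuation.map_sum_le w fun i _ ↦ ?_) hss
    have e : P.coeff i * G i - P.coeff i * i * s ^ (i - 1) = P.coeff i * (G i - i * s ^ (i - 1)) := by ring
    rw [e, map_mul]
    calc w (P.coeff i) * w (G i - i * s ^ (i - 1)) ≤ 1 * w (s' - s) := by
          gcongr
          · exact hP i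
          · exact hGi i
      _ = w (s' - s) := one_mul _
  have hDw : w D = 1 := by
    have e : D = P.derivative.eval s + (D - P.derivative.eval s) := by ring
    rw [e, Valuation.map_add_eq_of_lt_left w (by rw [hd]; exact hDd), hd]
  have hD0 : D ≠ 0 := by
    intro h; rw [h, map_zero] at hDw; exact zero_ne_one hDw
  have : (s' - s) * D = 0 := by rw [← hdiff, h0, h0', sub_self]
  rcases mul_eq_zero.mp this with h | h
  · exact sub_eq_zero.mp h
  · exact absurd h hD0

/-- **Hensel's lemma in the valuation ring of an algebraically closed valued field, with
uniqueness**: an integral polynomial `P` with a unit coefficient, an integral `s₀` with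
`|P(s₀)| < 1` and `|P'(s₀)| = 1` has exactly one integral root `s ≡ s₀ (mod 𝔪)` (existence:
the tree's `exists_root_val_sub_lt_one`; uniqueness: the previous theorem, `|P'(s)| = 1` by the
Lipschitz estimate).  Neukirch, *ANT*, Ch. II (4.6), (6.2) (`K̄_v` is henselian).
[cite: NeukirchANT1999, Ch. II (4.6)] -/
theorem exists_root_near_unique [IsAlgClosed L] {P : L[X]} (hP : ∀ i, w (P.coeff i) ≤ 1)
    (hunit : ∃ i, w (P.coeff i) = 1) {s₀ : L} (hs₀ : w s₀ ≤ 1) (hP₀ : w (P.eval s₀) < 1)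
    (hd₀ : w (P.derivative.eval s₀) = 1) :
    ∃ s : L, w s ≤ 1 ∧ w (s - s₀) < 1 ∧ P.eval s = 0 ∧
      ∀ s' : L, w s' ≤ 1 → w (s' - s₀) < 1 → P.eval s' = 0 → s' = s := by
  obtain ⟨s, hs, hss₀, hroot⟩ := exists_root_val_sub_lt_one (w := w) P.natDegree P le_rfl hP hunit s₀ hs₀ hP₀
  have hd : w (P.derivative.eval s) = 1 := by
    have h1 : w (P.derivative.eval s - P.derivative.eval s₀) < 1 :=
      lt_of_le_of_lt (val_eval_sub_eval_le w (val_coeff_derivative_le w hP) hs hs₀) hss₀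
    have e : P.derivative.eval s = P.derivative.eval s₀ + (P.derivative.eval s - P.derivative.eval s₀) := by
      ring
    rw [e, Valuation.map_add_eq_of_lt_left w (by rw [hd₀]; exact h1), hd₀]
  refine ⟨s, hs, hss₀, hroot, fun s' hs' hs'₀ h0' ↦ ?_⟩
  have hss : w (s' - s) < 1 := by
    have e : s' - s = (s' - s₀) - (s - s₀) := by ring
    rw [e]
    exact lt_of_le_of_lt (Valuation.map_sub w _ _) (max_lt hs'₀ hss₀)
  exact eq_of_eval_eq_zero_of_val_derivative_eval_eq_one w hP hs hs' hss hd hroot h0'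

end Roots

end Literature.NumberTheory.EllipticCurves

/-! ## §2 Points of `E₁` with prescribed parameter in the layer `K_v(ζ)` -/

namespace IsDedekindDomain.HeightOneSpectrum

open Literature.NumberTheory.EllipticCurves Literature.NumberTheory.GaloisRepresentations Field
  Literature.NumberTheory.EllipticCurves.FormalGroupChart

variable {K : Type u} [Field K] [NumberField K] {v : HeightOneSpectrum (𝓞 K)}
  {w : Valuation (AlgebraicClosure (v.adicCompletion K)) ℝ≥0}
  (hw : ∀ x, (w x : ℝ) = spectralNorm (v.adicCompletion K) (AlgebraicClosure (v.adicCompletion K)) x)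

include hw in
/-- **Every `z ∈ 𝔪 ∩ K_v(ζ)` is the parameter of a point of `E₁` with coordinates in `K_v(ζ)`**
(hypothesis `hlift` of `FormalGroupChart.exists_map_sub_eq_of_sum_eq_zero`).  For an elliptic
Weierstrass equation `X` over `K_v` with `w`-integral base change to `K̄_v`, a root of unity `ζ`
(`ζ^m = 1`) and `z ∈ K_v(ζ)` with `|z|_v < 1`, there is `P ∈ E₁(K̄_v)` with `z(P) = z` and
coordinates in `K_v(ζ)`: Hensel on the monic cubic `v³ + uv² + tz³v - a₆z⁶` of
`FormalGroupChart.approxRoot` and descent by `FormalGroupChart.root_unique`.  Silverman, *AEC*,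
Prop. VII.2.2 (surjectivity of `E₁(K) → Ê(𝓜)` over a complete field).
[cite: SilvermanAEC2009, Prop. VII.2.2] -/
theorem exists_mem_kernel_mem_range_zCoord_eq (X : WeierstrassCurve (v.adicCompletion K))
    [X.IsElliptic] [hV : (X.baseChange (AlgebraicClosure (v.adicCompletion K))).IsIntegral w.integer]
    {ζ : AlgebraicClosure (v.adicCompletion K)} {m : ℕ} (hm0 : m ≠ 0) (hζ : ζ ^ m = 1)
    (z : IntermediateField.adjoin (v.adicCompletion K) {ζ})
    (hz : w (z : AlgebraicClosure (v.adicCompletion K)) < 1) :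
    ∃ P : (X.baseChange (AlgebraicClosure (v.adicCompletion K))).toAffine.Point,
      P ∈ kernel w (X.baseChange (AlgebraicClosure (v.adicCompletion K))) ∧
      P ∈ (WeierstrassCurve.Affine.Point.map
        (IntermediateField.val (IntermediateField.adjoin (v.adicCompletion K) {ζ}))).range ∧
      P.zCoord = z := by
  -- notation
  let E := v.adicCompletion K
  let L := AlgebraicClosure (v.adicCompletion K)
  let V : WeierstrassCurve L := X.baseChange L
  let Kn : IntermediateField E L := IntermediateField.adjoin E {ζ}
  have hz0_or : (z : L) = 0 ∨ (z : L) ≠ 0 := em _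
  rcases hz0_or with hz0 | hz0
  · refine ⟨0, (kernel w V).zero_mem, AddSubgroup.zero_mem _, ?_⟩
    rw [WeierstrassCurve.Affine.Point.zCoord_zero, hz0]
  set z₀ : L := (z : L) with hz₀def
  have hz₀pos : 0 < w z₀ := (Valuation.pos_iff w).mpr hz0
  -- the approximate root of the monic cubic
  obtain ⟨hu, hGu, hv1⟩ := approxRoot (V := V) (w := w) hz
  set u : L := 1 - V.a₁ * z₀ - V.a₂ * z₀ ^ 2 with hudef
  set t : L := V.a₃ + V.a₄ * z₀ with htdef
  have ha₆ : w V.a₆ ≤ 1 := val_a₆_le_one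
  have ht1 : w t ≤ 1 := by
    refine (Valuation.map_add w _ _).trans (max_le val_a₃_le_one ?_)
    rw [map_mul]; exact mul_le_one' val_a₄_le_one hz.le
  -- the cubic as the image of an integral polynomial
  have hT3 : w (t * z₀ ^ 3) ≤ 1 := by
    rw [map_mul, map_pow]; exact mul_le_one' ht1 (pow_le_one₀ zero_le hz.le)
  have hA6 : w (-(V.a₆ * z₀ ^ 6)) ≤ 1 := by
    rw [Valuation.map_neg, map_mul, map_pow]; exact mul_le_one' ha₆ (pow_le_one₀ zero_le hz.le)
  let U : w.integer := ⟨u, hu.le⟩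
  let T3 : w.integer := ⟨t * z₀ ^ 3, hT3⟩
  let A6 : w.integer := ⟨-(V.a₆ * z₀ ^ 6), hA6⟩
  let f : w.integer[X] := C 1 * Polynomial.X ^ 3 + C U * Polynomial.X ^ 2 + C T3 * Polynomial.X + C A6
  set H : L[X] := f.map (algebraMap w.integer L) with hHdef
  have hHcoeff : ∀ i, w (H.coeff i) ≤ 1 := fun i ↦ by rw [hHdef, coeff_map]; exact (f.coeff i).2
  have hHeval : ∀ x : L, H.eval x = x ^ 3 + u * x ^ 2 + t * z₀ ^ 3 * x - V.a₆ * z₀ ^ 6 := by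
    intro x
    rw [hHdef, eval_map]
    simp only [f, eval₂_add, eval₂_mul, eval₂_C, eval₂_X_pow, eval₂_X, map_one, one_mul]
    change x ^ 3 + u * x ^ 2 + t * z₀ ^ 3 * x + -(V.a₆ * z₀ ^ 6) = _
    ring
  have hHunit : ∃ i, w (H.coeff i) = 1 := ⟨3, by
    rw [hHdef, coeff_map]
    have : f.coeff 3 = 1 := by
      simp only [f, coeff_add, coeff_C_mul, coeff_X_pow, coeff_X, coeff_C]
      norm_num
    rw [this, map_one, map_one]⟩
  -- Hensel: a root `v₀ ≡ -u`
  have hs₀ : w (-u) ≤ 1 := by rw [Valuation.map_neg]; exact hu.le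
  have hHs₀ : w (H.eval (-u)) < 1 := by
    rw [hHeval]
    refine lt_of_le_of_lt ?_ (pow_lt_one₀ zero_le hz three_ne_zero)
    convert hGu using 2
  obtain ⟨v₀, hv₀1, hv₀u, hv₀root⟩ :=
    exists_root_val_sub_lt_one (w := w) 3 H (natDegree_map_le.trans natDegree_cubic_le) hHcoeff hHunit
      (-u) hs₀ hHs₀
  have hwv₀ : w v₀ = 1 := hv1 v₀ (by rw [← sub_neg_eq_add]; exact hv₀u)
  -- the point `(x, y)`, `y = v₀ / z₀³`, `x = -z₀ y`
  set y : L := v₀ / z₀ ^ 3 with hydef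
  set x : L := -z₀ * y with hxdef
  have hz₀3 : z₀ ^ 3 ≠ 0 := pow_ne_zero 3 hz0
  have hyz : y * z₀ ^ 3 = v₀ := by rw [hydef, div_mul_cancel₀ v₀ hz₀3]
  have hwy : w y * w z₀ ^ 3 = 1 := by rw [← map_pow, ← map_mul, hyz, hwv₀]
  have hg : z₀ ^ 3 * y ^ 3 + (1 - V.a₁ * z₀ - V.a₂ * z₀ ^ 2) * y ^ 2 + (V.a₃ + V.a₄ * z₀) * y
      - V.a₆ = 0 := by
    have h1 := monic_cubic_eval (V := V) z₀ y
    rw [hyz] at h1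
    have h2 : v₀ ^ 3 + (1 - V.a₁ * z₀ - V.a₂ * z₀ ^ 2) * v₀ ^ 2 + (V.a₃ + V.a₄ * z₀) * z₀ ^ 3 * v₀
        - V.a₆ * z₀ ^ 6 = 0 := by
      rw [← hv₀root, hHeval]
    rw [h2] at h1
    have hz₀6 : z₀ ^ 6 ≠ 0 := pow_ne_zero 6 hz0
    exact (mul_eq_zero.mp h1.symm).resolve_left hz₀6
  have heq : V.toAffine.Equation x y := equation_of_root hg
  have hns : V.toAffine.Nonsingular x y := (WeierstrassCurve.Affine.equation_iff_nonsingular).mp heq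
  have hx1 : 1 < w x := one_lt_val_of_root hz₀pos hz hwy
  -- descent: `y ∈ K_v(ζ)`
  have hy0 : y ≠ 0 := by
    intro h; rw [h, map_zero, zero_mul] at hwy; exact zero_ne_one hwy
  have hyK : y ∈ Kn := by
    refine mem_adjoin_of_forall_smul_eq (v := v) fun σ hσ ↦ ?_
    have hσz : σ • z₀ = z₀ := (forall_smul_eq_self_iff_smul_eq hm0 hζ σ).mpr hσ z₀ z.2
    have hσa : ∀ a : E, σ • (algebraMap E L a) = algebraMap E L a := fun a ↦ smul_algebraMap σ a
    have hσa₁ : σ • V.a₁ = V.a₁ := hσa X.a₁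
    have hσa₂ : σ • V.a₂ = V.a₂ := hσa X.a₂
    have hσa₃ : σ • V.a₃ = V.a₃ := hσa X.a₃
    have hσa₄ : σ • V.a₄ = V.a₄ := hσa X.a₄
    have hσa₆ : σ • V.a₆ = V.a₆ := hσa X.a₆
    -- `σ y` is a root of the same cubic
    have hg' : z₀ ^ 3 * (σ • y) ^ 3 + (1 - V.a₁ * z₀ - V.a₂ * z₀ ^ 2) * (σ • y) ^ 2
        + (V.a₃ + V.a₄ * z₀) * (σ • y) - V.a₆ = 0 := by
      have h := congrArg (fun e : L ↦ σ • e) hg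
      simp only [smul_sub, smul_add, smul_mul', smul_pow', smul_zero, smul_one, hσz, hσa₁, hσa₂,
        hσa₃, hσa₄, hσa₆] at h
      exact h
    have hwy' : w (σ • y) * w z₀ ^ 3 = 1 := by rw [spectralValuation_smul hw]; exact hwy
    exact (root_unique hz₀pos hz hg hg' hwy hwy').symm
  have hxK : x ∈ Kn := by
    rw [hxdef, neg_mul]
    exact neg_mem (mul_mem z.2 hyK)
  -- the point over `K_v(ζ)`
  have hns₀ : (X.baseChange Kn).toAffine.Nonsingular (⟨x, hxK⟩ : Kn) ⟨y, hyK⟩ :=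
    (WeierstrassCurve.Affine.baseChange_nonsingular (W := X) (IntermediateField.val Kn).injective
      (⟨x, hxK⟩ : Kn) ⟨y, hyK⟩).mp hns
  refine ⟨.some x y hns, some_mem_kernel hns hx1, ⟨.some ⟨x, hxK⟩ ⟨y, hyK⟩ hns₀, ?_⟩, ?_⟩
  · rw [WeierstrassCurve.Affine.Point.map_some]
    rfl
  · rw [WeierstrassCurve.Affine.Point.zCoord_some, hxdef]
    field_simp

end IsDedekindDomain.HeightOneSpectrum

end
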